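import Summits.CriticalPhenomena.PercolationContinuityZ3.Theorems.Transplant.KNCellsBoxProdZ2ChainU
import HarnessLib

/-!
# The corridor chain of `X □ ℤ²` as target steps in the `U`-restricted graph WITH ENLARGED TARGETS (design (D), lead V56 order G4(b);
# HOME/ENTRY-SEED-STAR.md §11 (c5)): step `i` of the constant schedule has target `T_i = (U ∩ (W × core_{i+1})) ∪ Rim_i` — the full cross-section
# of the next core (the TRUE target `T'_i`, `= X^{(i+1)}_0`, linked by construction) together with a RIM PART `Rim_i ⊆ D_i` (the faces assigned to
# contacts within `L'` of the band's fibre rim, whose kit clause is then trivial); the excess `P(root ↔ Rim_i)` is paid by the collar bound and the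
# chain is consumed by `KSchA.hreach_of_chain_edge_sub` (p216676) with `T' i := U ∩ (W × core_{i+1})`

builds on p205010 (kernel theorem, internal audit signed; external expert review pending) — nothing in this file uses p205010.
Lane `prim-bschramm`, seat `prim-bschramm-p2` (G4); helper file (`--supports stmt-CriticalPhenomena-4575`).

* `ChainURData` = `ChainUData` + `Rim : ℕ → Finset (W × Site 2)`; `stepTR i = stepT i ∪ Rim i`, `stepR i : TStep (restrictGraph (X □ zdGraph 2) U)`;
* `stepT_subset_stepTR`, `stepT_eq_X_zero'` (the link for the true targets), `stepTR_subset_stepD` (given `Rim i ⊆ D_i`), `stepTR_sdiff_subset`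
  (`T_i \ T'_i ⊆ Rim_i`, for the excess), **`kitsAt_stepR`** (as `kitsAt_step`, kit clause towards the enlarged target).
[cite: KozmaNitzan2024, §4 Lemma 10 (p. 17), Lemma 12 (pp. 23–25), p. 30]
-/

noncomputable section

open MeasureTheory ProbabilityTheory
open scoped ENNReal

namespace Summit.CriticalPhenomena.PercolationContinuityZ3.Theorems

namespace Transplant

namespace BoxProdZ2

open Literature.Probability.Percolation Literature.Probability.LatticeModels SimpleGraph
open Literature.Probability.Percolation.KozmaNitzan
open Literature.Probability.Percolation.KozmaNitzan.Cells (sgOf sgOf_sign)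
open KNLevels ChainPlanar

variable {W : Type} (X : SimpleGraph W) [X.LocallyFinite] [DecidableEq W]

/-- **Chain data with rim targets**: the corridor chain data and, per step, the rim part of the enlarged target. [this work] -/
structure ChainURData (W : Type) extends ChainUData W where
  /-- the rim part of the enlarged target of step `i` -/
  Rim : ℕ → Finset (W × Site 2)

namespace ChainURData

variable {X} (P : ChainURData W)

/-- **The enlarged target of step `i`**: the next core's cross-section and the rim part. [cite: KozmaNitzan2024, §4 Lemma 10 (p. 17: T)] -/
def stepTR (i : ℕ) : Finset (W × Site 2) := P.stepT i ∪ P.Rim i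

variable (X)

/-- **Step `i` with the enlarged target.** [cite: KozmaNitzan2024, §4 Lemma 12 (pp. 23–25)] -/
def stepR (i : ℕ) : TStep (restrictGraph (X □ zdGraph 2) P.U) := ⟨P.stepL X i, P.stepD i, P.stepTR i, P.Rlev, P.N, P.j₀, P.j₁⟩

omit [X.LocallyFinite] in
/-- The true target lies in the enlarged target. [folklore] -/
theorem stepT_subset_stepTR (i : ℕ) : P.stepT i ⊆ (P.stepR X i).T := Finset.subset_union_left

omit [X.LocallyFinite] in
/-- **The true targets link the chain**: `T'_i = X^{(i+1)}_0`. [cite: KozmaNitzan2024, §4 Lemma 12] -/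
theorem stepT_subset_X_zero_succ (i : ℕ) : P.stepT i ⊆ (P.stepR X (i + 1)).L.X 0 := by
  rw [P.stepT_eq_X_zero X i]; exact subset_rfl

omit [X.LocallyFinite] in
/-- The excess part of the enlarged target is inside the rim part. [folklore] -/
theorem stepTR_sdiff_subset (i : ℕ) : (P.stepR X i).T \ P.stepT i ⊆ P.Rim i := by
  intro v hv
  rw [Finset.mem_sdiff] at hv
  rcases Finset.mem_union.1 hv.1 with h | h
  · exact absurd h hv.2
  · exact h

omit [X.LocallyFinite] in
/-- The sources agree. [folklore] -/
theorem stepR_o (i : ℕ) : (P.stepR X i).L.o = P.root := rfl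

variable {P}

/-- **`T_i ⊆ D_i`** when the rim part lies in the region. [folklore] -/
theorem stepTR_subset_stepD (hR : 100 * P.R' ≤ P.t) (hRim : ∀ i, P.Rim i ⊆ P.stepD i) {i : ℕ} (hi : i ≤ Sched.nLast) :
    P.stepTR i ⊆ P.stepD i :=
  Finset.union_subset (ChainUData.stepT_subset_stepD hR hi) (hRim i)

/-- **`KitsAt` of the enlarged step `i`** from a subbox region, finite support, the source off the region, the count inequality and the per-level
kit clause towards the ENLARGED target (rim contacts: face inside `Rim_i`, clause trivial; deep contacts: route into the next core).
[cite: KozmaNitzan2024, §4 Lemma 10 (p. 17)] -/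
theorem kitsAt_stepR (hr : P.C.r = 4 * P.t) (hR : 100 * P.R' ≤ P.t) (hRl : P.Rlev + 1 ≤ P.R') (hRim : ∀ i, P.Rim i ⊆ P.stepD i) {β : W}
    (hβ : ∀ s ∈ P.C.Q P.x ∪ P.C.Hfull P.x P.du, (β, s) ∈ P.U) {i : ℕ} (hi : i ≤ Sched.nLast)
    {Wt : Sym2 (W × Site 2) → unitInterval} {p : unitInterval} {Δ : ℕ} {δ : ℝ}
    (hsub : KNLevels.IsSubbox (restrictGraph (X □ zdGraph 2) P.U) Wt p (P.stepD i)) (hfin : FinSupp Wt P.Sfin) (hDS : P.stepD i ⊆ P.Sfin)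
    (ho : P.root ∉ P.stepD i) (hoS : P.root ∈ P.Sfin) (hj : P.j₁ ≤ P.Rlev)
    (hcount : 1 / (1 - (p : ℝ)) ^ (Δ * P.N) ≤ δ * ((Finset.Icc P.j₀ P.j₁).card : ℝ))
    (hkits : ∀ j ∈ Finset.Icc P.j₀ P.j₁, ∃ (σ : SData (W × Site 2)) (S : Finset (W × Site 2)), SHyp (P.stepL X i) j σ ∧ σ.N ≤ P.N ∧
      (1 - (p : ℝ) ^ σ.sB) ^ σ.k ≤ δ ∧ S ⊆ (P.stepL X i).X j ∧ S ⊆ P.stepD i ∧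
      (∀ x ∈ σ.K, ∀ e ∈ σ.seed x, e ∉ wireSet (↑S : Set (W × Site 2))) ∧ (∀ x ∈ σ.K, σ.face x ⊆ S) ∧
      (∀ x ∈ σ.K, 1 - 3 * δ ≤ (prodBernoulli Wt).real {ω | ∃ u ∈ σ.face x,
        1 - δ < (prodBernoulli (pinW Wt (wireSet (↑S : Set (W × Site 2))) ω)).real
          (⋃ t ∈ P.stepTR i, openConnIn (↑(P.stepD i) : Set (W × Site 2)) u t)})) :
    (P.stepR X i).KitsAt Wt p Δ δ :=
  ⟨lhyp_U X P.U (P.lo i) (P.hi i) hsub hfin hDS (ChainUData.encl X hR hRl hi) ho hoS, hj,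
    stepTR_subset_stepD hR hRim hi, (ChainUData.stepT_nonempty hr hR hβ hi).mono (P.stepT_subset_stepTR X i), hcount, hkits⟩

end ChainURData

end BoxProdZ2

end Transplant

end Summit.CriticalPhenomena.PercolationContinuityZ3.Theorems

end
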